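import Summits.AnomalousDissipation.AnomalousDissipation.Theorems.ScalarAnomalySteadySourceFormal.Negative.ColdStartCeiling
import Literature.Analysis.FunctionSpaces.TorusFluidGlue
import HarnessLib

/-!
# Refuted strengthening of `stub_sectorMixerRealizable` (S1 of line `budgeted-mixer-template`,
crux `TwoAndHalfD.ScalarAnomalySteadySourceFormal`, stmt-AnomalousDissipation-0448): lag count `n = 1`

`sectorMixer_false_at_lag_one`: the registered S1 signature with the existential lag count `n`
specialised to `1` (so (small) reads `4τ‖h‖² ≤ 2¹c₀` and (Floor) is asked at lag `1·τ`) is FALSE —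
for every choice of the remaining data. Only (small), (Floor), `c₀ > 0`, `κ = ν_j > 0`, `τ > 0` and
the smoothness / incompressibility of the NS velocity are used (`not_floor_lag_one_of_small`):
the cold start from `s = 0` has input power `≤ τ‖h‖² ≤ c₀/2 < c₀`. Hence every S1 witness has
`n ≥ 2` (NC1 of `Cruxes/ScalarAnomalySteadySourceFormal/DREFUTE-stub_sectorMixerRealizable.md`). [folklore]
-/

open MeasureTheory Set Filter
open _root_.Topology

noncomputable section

namespace Summit.AnomalousDissipation.AnomalousDissipation.Theorems.ScalarAnomalySteadySourceFormal.Negative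

open Literature.Analysis Literature.Analysis.FunctionSpaces
open Literature.Analysis.FluidPDE Literature.Analysis.FluidPDE.Torus

set_option linter.dupNamespace false

/-- **S1 at lag count `n = 1` is false** (the stub's body verbatim with `n ↦ 1`, the conjunct
`1 ≤ n` dropped as trivially true). [folklore] -/
theorem sectorMixer_false_at_lag_one :
    ¬ ∃ (g : UnitAddTorus (Fin 2) → EuclideanSpace ℝ (Fin 2)) (h : UnitAddTorus (Fin 2) → ℝ),
      Torus.IsSmooth g ∧ Torus.IsDivFree g ∧ Torus.HasZeroMean g ∧
      Torus.IsSmooth h ∧ Torus.HasZeroMean h ∧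
      ∃ (ν : ℕ → ℝ) (v : ℕ → ℝ → UnitAddTorus (Fin 2) → EuclideanSpace ℝ (Fin 2))
        (p : ℕ → ℝ → UnitAddTorus (Fin 2) → ℝ) (S : ℕ → Set (UnitAddTorus (Fin 2) → ℝ))
        (τ E c₀ : ℝ),
        (∀ j, 0 < ν j) ∧ Tendsto ν atTop (𝓝 0) ∧ 0 < τ ∧ 0 < c₀ ∧
        4 * τ * Torus.scalarL2Sq h ≤ 2 ^ (1 : ℕ) * c₀ ∧
        (∀ j, Torus.IsClassicalNSSolutionOn (Set.Ici 0) (ν j) (fun _ => g) (v j) (p j)) ∧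
        (∀ j t, 0 ≤ t → ∫ x, ‖v j t x‖ ^ 2 ≤ E) ∧
        (∀ j (s T' : ℝ), 0 ≤ s → ∀ φ : ℝ → UnitAddTorus (Fin 2) → ℝ,
            Torus.IsClassicalScalarTransportOn (Set.Icc s T') (ν j) (v j) φ → φ s ∈ S j →
            ∀ t ∈ Set.Icc s T', φ t ∈ S j) ∧
        (∀ j (θ : ℝ → UnitAddTorus (Fin 2) → ℝ),
            Torus.IsClassicalScalarTransportForcedOn (Set.Ici 0) (ν j) (v j) (fun _ => h) θ →
            θ 0 = (fun _ => (0 : ℝ)) → ∀ t, 0 ≤ t → θ t ∈ S j) ∧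
        (∀ j (s : ℝ), 0 ≤ s → ∀ φ : ℝ → UnitAddTorus (Fin 2) → ℝ,
            Torus.IsClassicalScalarTransportOn (Set.Icc s (s + τ)) (ν j) (v j) φ → φ s ∈ S j →
            Torus.scalarL2Sq (φ (s + τ)) ≤ 4⁻¹ * Torus.scalarL2Sq (φ s)) ∧
        (∀ j (s : ℝ), 0 ≤ s → ∀ ρ : ℝ → UnitAddTorus (Fin 2) → ℝ,
            Torus.IsClassicalScalarTransportForcedOn (Set.Icc s (s + (1 : ℕ) * τ)) (ν j) (v j) (fun _ => h) ρ →
            ρ s = (fun _ => (0 : ℝ)) → c₀ ≤ ∫ x, h x * ρ (s + (1 : ℕ) * τ) x) := by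
  rintro ⟨g, h, -, -, -, hhs, -, ν, v, p, S, τ, E, c₀, hν, -, hτ, hc₀, hsmall, hNS, -, -, -, -, hFloor⟩
  exact not_floor_lag_one_of_small (hν 0) hτ hc₀ (hNS 0).smooth_velocity (hNS 0).divFree hhs hsmall
    (hFloor 0)

end Summit.AnomalousDissipation.AnomalousDissipation.Theorems.ScalarAnomalySteadySourceFormal.Negative

end
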